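import Literature.AlgebraicGeometry.HodgeTheory.BettiUniverseKunnethHodgePowersNormalForm
import Literature.AlgebraicGeometry.HodgeTheory.HypersurfaceCutOutByLefschetz
import Literature.AlgebraicGeometry.HodgeTheory.OddHypersurfaceHodgeConjecture
import Literature.AlgebraicGeometry.HodgeTheory.ComplexConjugationHolds

/-!
# K2-A stub KS (route `CyclicUnitaryPowers`, item stmt-HodgeConjecture-19545) — the Künneth summand normal form

Discharges the registered stub `stub_summandHodgeNormalFormSurface` (skeleton `3dcaec2ceafa`, K2-A line
`unitary-kunneth-fft` v2) of the deciding crux `PowersHodgeOfDeckCommutators` (rank 3) of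
`route-HodgeConjecture-CyclicUnitaryPowers`; landed `--supports stmt-HodgeConjecture-19545` (it does not close
the item: stubs U, P, A remain). Sorry-free; axioms `propext`, `Classical.choice`, `Quot.sound`.

## Statement

`stub_summandHodgeNormalFormSurface` — the registered signature VERBATIM: for a prime `p ≥ 7`, a smooth
projective surface `X` cut out in `ℙ³` by `x₃^p − f(x₀,x₁,x₂)` (`f` a ternary form of degree `p`), a limit fan
`Fan.mk Y π` on `k + 1` copies of `X`, and a Hodge class `x` (type `(q, q)`) of ONE tensor summand
`PowSummand X k κ` (`κ : PowIdx k (2q)`), the class `fanKunnethMap π hlim (2q) (powInsert X k κ x)` lies in the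
`ℚ`-span of the classes `E t`: `E` a Künneth insertion of covariant tensors of `H²(X)` decorated by a class with
algebraic complexification (left-nested cup chain on basis tensors), `t` a Hodge tensor of `T^{r,0} H²(X)`.

## Proof

The Literature theorem `BettiUniverse.fanKunnethMap_powInsert_mem_span_normalForm`
(`BettiUniverseKunnethHodgePowersNormalForm`: Voisin I Thm. 11.40 / Lemma 11.41 with Deligne's Tate-type factors)
at `n = 2`, fed with `H¹ = H³ = 0` and `H⁰, H⁴` algebraic for a smooth hypersurface surface in `ℙ³`
(`subsingleton_bettiCohomology_of_odd`, `algebraicClasses_eq_top_of_isHypersurfaceCutOutBy`, Voisin II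
Thm. 1.23 / Cor. 1.24–1.25); the defining form `x₃^p − f` is homogeneous of degree `p` (`rename_isHomogeneous`) and
non-zero (`IsSmoothProjective.ne_zero_of_isHypersurfaceCutOutBy`). Primality and `p ≥ 7` are not used.
-/

-- `Summit.HodgeConjecture.HodgeConjecture.Theorems` is the mandated namespace (single-problem summit), which
-- `linter.dupNamespace` flags; the lakefile turns the linter off tree-wide, restated here for stand-alone checks.
set_option linter.dupNamespace false

noncomputable section

namespace Summit.HodgeConjecture.HodgeConjecture.Theorems.CyclicUnitaryPowersSummandHodgeNormalFormSurface

open Literature.AlgebraicGeometry.Motives Literature.AlgebraicGeometry.HodgeTheory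
open Literature.AlgebraicGeometry.HodgeTheory.BettiUniverse
open CategoryTheory CategoryTheory.Limits

/-- **K2-A stub KS** (`SummandHodgeNormalFormSurface`, registered signature verbatim): the Künneth image of a Hodge
class of one tensor summand of `H^{2q}(X^{k+1})`, `X : x₃^p = f` a smooth cyclic surface in `ℙ³`, lies in the span of
the decorated Künneth insertions `E t` of Hodge tensors `t ∈ T^{r,0} H²(X)`. Proof: the generic normal form
`BettiUniverse.fanKunnethMap_powInsert_mem_span_normalForm` at `n = 2`. -/
theorem stub_summandHodgeNormalFormSurface :
    open Literature.AlgebraicGeometry.Motives Literature.AlgebraicGeometry.HodgeTheory Literature.AlgebraicGeometry.HodgeTheory.BettiUniverse CategoryTheory.Limits in Literature.AlgebraicGeometry.HodgeTheory.fulton1998_map_mem_algebraicClasses → ∀ ⦃p : ℕ⦄, p.Prime → 7 ≤ p → ∀ ⦃X : SchemeOver ℂ⦄ (hX : IsSmoothProjective 2 X), (∃ f : MvPolynomial (Fin 3) ℂ, f.IsHomogeneous p ∧ IsHypersurfaceCutOutBy 3 (MvPolynomial.X (Fin.last 3) ^ p - MvPolynomial.rename Fin.castSucc f) X) → ∀ [Module.Finite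 ℚ (bettiCohomology X 2)] [HodgeTensorFacts.{0, 0}] ⦃k : ℕ⦄ ⦃Y : SchemeOver ℂ⦄ (π : Fin (k + 1) → (Y ⟶ X)) (hlim : IsLimit (Fan.mk Y π)) (q : ℕ) (κ : PowIdx k (2 * q)) (x : PowSummand X k κ), x ∈ (powSummandHodge exists_isReal_hodgeModel_holds hX k κ).hodgeClasses (q : ℤ) → fanKunnethMap π hlim (2 * q) (powInsert X k κ x) ∈ Submodule.span ℚ {x : bettiCohomology Y (2 * q) | ∃ (q' r : ℕ) (u : Fin r → Fin (k + 1)) (wdec : bettiCohomology Y (2 * q')) (_ : ofRatClass (ComplexPoints Y) (2 * q') wdec ∈ algebraicClasses Y q') (E : hodgeTensorSpace (bettiCohomology X 2) r 0 →ₗ[ℚ] bettiCohomology Y (2 * q)) (_ : (∀ w : Fin r → Fin (Module.finrank ℚ (bettiCohomology X 2)), (⟨2 * q, E ((PiTensorProduct.tprod ℚ fun i => (Module.finBasis ℚ (bettiCohomology X 2)) (w i)) ⊗ₜ[ℚ] (PiTensorProduct.tprod ℚ fun i : Fin 0 => (Fin.elim0 i : Module.Dual ℚ (bettiCohomology X 2))))⟩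 : Σ n, bettiCohomology Y n) = List.foldl (fun (acc : Σ n, bettiCohomology Y n) (i : Fin r) => ⟨acc.1 + 2, cup Y acc.1 2 acc.2 (pull (π (u i)) 2 ((Module.finBasis ℚ (bettiCohomology X 2)) (w i)))⟩) ⟨2 * q', wdec⟩ (List.finRange r))) (t : hodgeTensorSpace (bettiCohomology X 2) r 0) (_ : (∃ p' : ℤ, ((r : ℤ) - ((0 : ℕ) : ℤ)) * ((2 : ℕ) : ℤ) = 2 * p' ∧ t ∈ ((hodge exists_isReal_hodgeModel_holds hX 2).tensorSpace r 0).hodgeClasses p')), x = E t} := by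
  intro hP p _ _ X hX hf _ _ k Y π hlim q κ x hx
  obtain ⟨f, hfd, hcut⟩ := hf
  have hXp : (MvPolynomial.X (Fin.last 3) ^ p : MvPolynomial (Fin 4) ℂ).IsHomogeneous p := by
    simpa using (MvPolynomial.isHomogeneous_X ℂ (Fin.last 3)).pow p
  have hF : (MvPolynomial.X (Fin.last 3) ^ p - MvPolynomial.rename Fin.castSucc f :
      MvPolynomial (Fin 4) ℂ).IsHomogeneous p := hXp.sub hfd.rename_isHomogeneous
  have hF0 : MvPolynomial.X (Fin.last 3) ^ p - MvPolynomial.rename Fin.castSucc f ≠ 0 :=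
    hX.ne_zero_of_isHypersurfaceCutOutBy hcut
  exact fanKunnethMap_powInsert_mem_span_normalForm exists_isReal_hodgeModel_holds hX hP
    (fun j hj hjn ↦ subsingleton_bettiCohomology_of_odd (n := 2) hX hF hF0 hcut hj hjn)
    (fun a ha ↦ algebraicClasses_eq_top_of_isHypersurfaceCutOutBy (n := 2) hX hF hF0 hcut ha) π hlim q κ x hx

end Summit.HodgeConjecture.HodgeConjecture.Theorems.CyclicUnitaryPowersSummandHodgeNormalFormSurface

end
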